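import Mathlib
import Summits.RiemannHypothesis.RiemannHypothesis.Theorems.WeilFarFloorCoshQuotientLowerRH
import Summits.RiemannHypothesis.RiemannHypothesis.Theorems.WeilFarFloorCoshCouplingRH
import Summits.RiemannHypothesis.RiemannHypothesis.Theorems.WeilFarFloorCoshOptimalBudgets
import HarnessLib

/-!
# The budgets of the C-XIII″ rate estimate, discharged under RH at the scale `h = s = η = e^{−2a}`

Helper file (`--supports stmt-RiemannHypothesis-0098`, lead-track anchor: Weil-positivity window ladder, format-C far bound),
pure proofs.  Seat rh-explicit-weil-1 gen13 (memo `run/shared/lean/pub/rh-explicit/rh-explicit-weil-1/FORMAT-K3.md` §14.6, §14.11).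

The abstract rate estimate for the floor (`WeilFarFloorCoshOptimalRateRH.farCoercivityFloor_le_coshQuotient_rate_of_RH`, the `2 × 2`
block argument) takes scalar budgets on the window range `[a + h, a + h + 1]`: a coupling constant `J_c`
(`∫(T_{b'}C − (e^{b'}+b')C)² ≤ J_c·‖C‖²`), a lower bound `R₋` of the cosh quotient, the window weight `P₊`, the weight sum `W`, the
eigen-shift `τ`, and ONE largeness condition `16s²P₊ + 4Ψ(ηh/2) + 1 ≤ R₋`; its error is
`6Ws + 2(2J_c + 5s²(2W+τ)²)/(R₋ − 16s²P₊ − 4Ψ) + 11η + 25(h/2)e^{2(a+h+1)}/((a+h) + sinh(a+h))` on top of `R_c(a+h)`.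
This file DISCHARGES those budgets under RH, independently of the block argument (so that it can land before it):

  **`exists_rateBudgets_of_RH`**: under RH there are `C, a₀` such that for every `a ≥ a₀`, with `h = e^{−2a}`, `J_c = K₁(a+h+1)⁵`
  (stage 1, `WeilFarFloorCoshCouplingRH.integral_primeShiftOp_coshProfile_sub_sq_le_of_RH`, von Koch), `R₋ = e^a − C_q((a+2)³+1)`
  (`coshQuotient_ge_of_RH`), `W = 38(e^{a+h+1}+1)` (`weightSum_le`), `τ = e^{a+h+1} + (a+h+1)`, `P₊ = (a+h+1) + sinh(a+h+1)`,
  `s = η = h`: the coupling, floor and largeness hypotheses hold, and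
  `R_c(a+h) + [error] ≤ R_c(a) + C·(a+2)⁵·e^{−a}` (`C = 8K₁ + 20·154²e⁴ + 50e⁴ + 1256e² + 11`; window continuity
  `abs_coshQuotient_sub_le` for `R_c(a+h) − R_c(a)`; the largeness condition is the eventuality `M₁(a+2)³e^{−a} < ½`,
  `M₁ = 2C_q + 13 + 32e²`).

Combined with the block argument this gives C-XIII″ with the rate `λ_max(a) ≤ R_c(a) + C·(a+2)⁵·e^{−a}`
(`WeilFarFloorCoshOptimalRateRH.farCoercivityFloor_sub_coshQuotient_le_of_RH`).  Standard axioms only; RH enters as Mathlib's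
`RiemannHypothesis`.
-/

set_option linter.dupNamespace false
set_option autoImplicit false

noncomputable section

open MeasureTheory Set Filter
open scoped Real Topology ArithmeticFunction.vonMangoldt

namespace Summit.RiemannHypothesis.RiemannHypothesis.Theorems.WeilFormatC

namespace FloorCoshSplit

open Literature.NumberTheory.LFunctions FloorCosh FloorEnvelope

/-- **THE RATE BUDGETS UNDER RH.**  `∃ C a₀, ∀ a ≥ a₀`: `a ≥ 4` and, with `h = e^{−2a}`, there are `J_c > 0` and `R₋` such that
on `[a+h, a+h+1]` the cosh-profile coupling is `≤ J_c·(b' + sinh b')`, the cosh quotient is `≥ R₋`,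
`16h²P₊ + 4Ψ(h·h/2) + 1 ≤ R₋`, and `R_c(a+h) + 6Wh + 2(2J_c + 5h²(2W+τ)²)/(R₋ − 16h²P₊ − 4Ψ) + 11h + 25(h/2)e^{2(a+h+1)}/P(a+h)
≤ R_c(a) + C·(a+2)⁵·e^{−a}` (`W = 38(e^{a+h+1}+1)`, `τ = e^{a+h+1} + a+h+1`, `P₊ = P(a+h+1)`, `P(b) = b + sinh b`). -/
theorem exists_rateBudgets_of_RH (hRH : RiemannHypothesis) :
    ∃ C a₀ : ℝ, ∀ a : ℝ, a₀ ≤ a → 4 ≤ a ∧ ∃ h Jc Rlow : ℝ, 0 < h ∧ h ≤ 1 / 6 ∧ 0 < Jc ∧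
      (∀ b' ∈ Icc (a + h) (a + h + 1), ∫ x in Ioo (-b') b',
        ((∑ n ∈ weilPrimeIndex b', (Λ n : ℝ) / Real.sqrt n *
            ((Icc (-b') b').indicator (fun y ↦ Real.cosh (y / 2)) (x - Real.log n)
              + (Icc (-b') b').indicator (fun y ↦ Real.cosh (y / 2)) (x + Real.log n)))
          - (Real.exp b' + b') * (Icc (-b') b').indicator (fun y ↦ Real.cosh (y / 2)) x) ^ 2
        ≤ Jc * (b' + Real.sinh b')) ∧
      (∀ b' ∈ Icc (a + h) (a + h + 1),
        Rlow ≤ primeShiftForm b' ((Icc (-b') b').indicator (fun y ↦ Real.cosh (y / 2))) / (b' + Real.sinh b')) ∧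
      (16 * h ^ 2 * ((a + h + 1) + Real.sinh (a + h + 1)) + 4 * weilArchTail (h * (h / 2)) + 1 ≤ Rlow) ∧
      (primeShiftForm (a + h) ((Icc (-(a + h)) (a + h)).indicator (fun y ↦ Real.cosh (y / 2))) / ((a + h) + Real.sinh (a + h))
          + 6 * (38 * (Real.exp (a + h + 1) + 1)) * h
          + 2 * (2 * Jc + 5 * h ^ 2 * (2 * (38 * (Real.exp (a + h + 1) + 1)) + (Real.exp (a + h + 1) + (a + h + 1))) ^ 2)
              / (Rlow - (16 * h ^ 2 * ((a + h + 1) + Real.sinh (a + h + 1)) + 4 * weilArchTail (h * (h / 2))))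
          + 11 * h + 25 * (h / 2) * Real.exp (2 * (a + h + 1)) / ((a + h) + Real.sinh (a + h))
        ≤ primeShiftForm a ((Icc (-a) a).indicator (fun y ↦ Real.cosh (y / 2))) / (a + Real.sinh a)
          + C * (a + 2) ^ 5 * Real.exp (-a)) := by
  classical
  obtain ⟨K₁, hK₁, hstage1⟩ := integral_primeShiftOp_coshProfile_sub_sq_le_of_RH hRH
  obtain ⟨Cq, hCq, hquot⟩ := coshQuotient_ge_of_RH hRH
  set CW := 154 ^ 2 * Real.exp 4 with hCW
  have hCW0 : 0 ≤ CW := by rw [hCW]; positivity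
  set M₁ := 2 * Cq + 13 + 32 * Real.exp 2 with hM₁
  have hM₁0 : 0 < M₁ := by rw [hM₁]; positivity
  refine ⟨8 * K₁ + 20 * CW + 50 * Real.exp 4 + 1256 * Real.exp 2 + 11, ?_⟩
  -- eventualities
  have hT1 : Tendsto (fun a : ℝ ↦ Real.exp (-a)) atTop (𝓝 0) := Real.tendsto_exp_neg_atTop_nhds_zero
  have hT3 : Tendsto (fun a : ℝ ↦ (a + 2) ^ 3 * Real.exp (-a)) atTop (𝓝 0) := by
    have h1 := ((Real.tendsto_pow_mul_exp_neg_atTop_nhds_zero 3).comp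
      (tendsto_atTop_add_const_right atTop (2 : ℝ) tendsto_id)).const_mul (Real.exp 2)
    rw [mul_zero] at h1
    refine h1.congr' (Eventually.of_forall fun a ↦ ?_)
    simp only [Function.comp_apply, id]
    rw [mul_left_comm, ← Real.exp_add]
    ring_nf
  have hev : ∀ᶠ a : ℝ in atTop, M₁ * ((a + 2) ^ 3 * Real.exp (-a)) < 1 / 2 := by
    have e2 : Tendsto (fun a : ℝ ↦ M₁ * ((a + 2) ^ 3 * Real.exp (-a))) atTop (𝓝 0) := by
      simpa using hT3.const_mul M₁
    exact e2.eventually (gt_mem_nhds (by norm_num))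
  obtain ⟨a₁, ha₁⟩ := Filter.eventually_atTop.1 hev
  refine ⟨max a₁ 4, fun a ha ↦ ?_⟩
  have hc2 := ha₁ a (le_trans (le_max_left _ _) ha)
  have ha4 : 4 ≤ a := le_trans (le_max_right _ _) ha
  have ha1 : 1 ≤ a := by linarith only [ha4]
  have ha0 : 0 < a := by linarith only [ha4]
  -- the scale `h = s = η = e^{−2a}`
  set h := Real.exp (-(2 * a)) with hh
  have hh0 : 0 < h := Real.exp_pos _
  have hh6 : h ≤ 1 / 6 := by
    rw [hh]
    have h1 : Real.exp (-(2 * a)) ≤ Real.exp (-2) := Real.exp_le_exp.2 (by linarith only [ha1])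
    have h2 : Real.exp (-2) * Real.exp 2 = 1 := by rw [← Real.exp_add]; simp
    have h3 : (6 : ℝ) ≤ Real.exp 2 := by
      have e1 := Real.exp_one_gt_d9
      have e2 : Real.exp 2 = Real.exp 1 ^ 2 := by rw [← Real.exp_nat_mul]; norm_num
      rw [e2]; nlinarith only [e1]
    have h4 := mul_le_mul_of_nonneg_left h3 (Real.exp_pos (-2)).le
    linarith only [h1, h2, h4]
  have hh1 : h ≤ 1 := by linarith only [hh6]
  have hh_ea : h ≤ Real.exp (-a) := by rw [hh]; exact Real.exp_le_exp.2 (by linarith only [ha1])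
  have hea : 0 < Real.exp (-a) := Real.exp_pos _
  have hea1 : Real.exp (-a) ≤ 1 := Real.exp_le_one_iff.2 (by linarith only [ha1])
  have heinv : Real.exp (-a) * Real.exp a = 1 := by rw [← Real.exp_add]; simp
  have hE2 : 1 ≤ Real.exp 2 := Real.one_le_exp (by norm_num)
  -- `X = a + 2` and its powers
  have hX1 : 1 ≤ a + 2 := by linarith only [ha1]
  have hX3_1 : 1 ≤ (a + 2) ^ 3 := one_le_pow₀ hX1
  have hX5_1 : 1 ≤ (a + 2) ^ 5 := one_le_pow₀ hX1
  have hX35 : (a + 2) ^ 3 ≤ (a + 2) ^ 5 := pow_le_pow_right₀ hX1 (by norm_num)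
  have hbX : a + h + 1 ≤ a + 2 := by linarith only [hh1]
  have hb10 : 0 ≤ a + h + 1 := by linarith only [ha1, hh0]
  -- the budgets
  have hcoupB : ∀ b' ∈ Icc (a + h) (a + h + 1), ∫ x in Ioo (-b') b',
      ((∑ n ∈ weilPrimeIndex b', (Λ n : ℝ) / Real.sqrt n *
          ((Icc (-b') b').indicator (fun y ↦ Real.cosh (y / 2)) (x - Real.log n)
            + (Icc (-b') b').indicator (fun y ↦ Real.cosh (y / 2)) (x + Real.log n)))
        - (Real.exp b' + b') * (Icc (-b') b').indicator (fun y ↦ Real.cosh (y / 2)) x) ^ 2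
      ≤ K₁ * (a + h + 1) ^ 5 * (b' + Real.sinh b') := by
    intro b' hb'
    have hb'1 : 1 ≤ b' := by linarith only [hb'.1, ha1, hh0]
    obtain ⟨-, h1⟩ := hstage1 b' hb'1
    refine h1.trans (mul_le_mul_of_nonneg_right ?_ ?_)
    · exact mul_le_mul_of_nonneg_left (pow_le_pow_left₀ (by linarith only [hb'1]) hb'.2 5) hK₁.le
    · have := Real.sinh_nonneg_iff.2 (show (0:ℝ) ≤ b' by linarith only [hb'1]); linarith only [this, hb'1]
  have hRlowB : ∀ b' ∈ Icc (a + h) (a + h + 1),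
      Real.exp a - Cq * ((a + 2) ^ 3 + 1)
        ≤ primeShiftForm b' ((Icc (-b') b').indicator (fun y ↦ Real.cosh (y / 2))) / (b' + Real.sinh b') := by
    intro b' hb'
    have hb'1 : 1 ≤ b' := by linarith only [hb'.1, ha1, hh0]
    have h1 := hquot b' hb'1
    have h2 : Real.exp a ≤ Real.exp b' := Real.exp_le_exp.2 (by linarith only [hb'.1, hh0])
    have h3 : Cq * (b' ^ 3 + 1) ≤ Cq * ((a + 2) ^ 3 + 1) :=
      mul_le_mul_of_nonneg_left (by
        nlinarith only [pow_le_pow_left₀ (by linarith only [hb'1] : (0:ℝ) ≤ b') (hb'.2.trans hbX) 3]) hCq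
    linarith only [h1, h2, h3]
  clear hstage1 hquot
  -- the archimedean tail at the cut `η(h/2) = h²/2`: `Ψ ≤ 2a + 3`
  have hΨ : weilArchTail (h * (h / 2)) ≤ 2 * a + 3 := by
    have ht0 : 0 < h * (h / 2) := by positivity
    have ht1 : h * (h / 2) ≤ 1 := by nlinarith only [hh0, hh1]
    have h1 := weilArchTail_le_half_log ht0 ht1
    have hh4 : h * h = Real.exp (-(4 * a)) := by rw [hh, ← Real.exp_add]; ring_nf
    have e0 : h * (h / 2) = Real.exp (-(4 * a)) / 2 := by rw [mul_div_assoc', hh4]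
    have e : 1 / (h * (h / 2)) = 2 * Real.exp (4 * a) := by
      rw [e0, Real.exp_neg]; field_simp
    rw [e, Real.log_mul (by norm_num) (Real.exp_pos _).ne', Real.log_exp] at h1
    have hl2 : Real.log 2 < 1 := by linarith only [Real.log_two_lt_d9]
    linarith only [h1, hl2]
  have hΨ0 : 0 ≤ weilArchTail (h * (h / 2)) := (weilArchTail_pos (by positivity)).le
  -- `P₊ = (b+1) + sinh(b+1) ≤ 2e^{a+2}` and `h²P₊ ≤ 2e²e^{−3a} ≤ 2e²e^{−a}`
  have heb : Real.exp (a + h + 1) ≤ Real.exp (a + 2) := Real.exp_le_exp.2 hbX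
  have heX1 : 1 ≤ Real.exp (a + 2) := Real.one_le_exp (by linarith only [ha1])
  have hXe : a + 2 ≤ Real.exp (a + 2) := by linarith only [Real.add_one_le_exp (a + 2)]
  have hPpB : (a + h + 1) + Real.sinh (a + h + 1) ≤ 2 * Real.exp (a + 2) := by
    have e1 : Real.sinh (a + h + 1) ≤ Real.exp (a + h + 1) := by
      rw [Real.sinh_eq]; linarith only [Real.exp_pos (-(a + h + 1)), Real.exp_pos (a + h + 1)]
    have e2 : a + h + 1 ≤ Real.exp (a + h + 1) := by linarith only [Real.add_one_le_exp (a + h + 1)]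
    linarith only [e1, e2, heb]
  have hPp0 : 0 ≤ (a + h + 1) + Real.sinh (a + h + 1) := by
    have := Real.sinh_nonneg_iff.2 hb10; linarith only [this, hb10]
  have hh2P : h ^ 2 * ((a + h + 1) + Real.sinh (a + h + 1)) ≤ 2 * Real.exp 2 * Real.exp (-a) := by
    have h2 : h ^ 2 * Real.exp (a + 2) = Real.exp 2 * Real.exp (-(3 * a)) := by
      rw [hh, ← Real.exp_nat_mul, ← Real.exp_add, ← Real.exp_add]; ring_nf
    have h3 : Real.exp (-(3 * a)) ≤ Real.exp (-a) := Real.exp_le_exp.2 (by linarith only [ha1])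
    have h4 := mul_le_mul_of_nonneg_left hPpB (sq_nonneg h)
    nlinarith only [h2, h3, h4, Real.exp_pos 2]
  -- the weight sum and the eigen-shift: `h²(2W + τ)² ≤ CW`
  have hsq : h ^ 2 * (2 * (38 * (Real.exp (a + h + 1) + 1)) + (Real.exp (a + h + 1) + (a + h + 1))) ^ 2 ≤ CW := by
    have hWτ : 2 * (38 * (Real.exp (a + h + 1) + 1)) + (Real.exp (a + h + 1) + (a + h + 1)) ≤ 154 * Real.exp (a + 2) := by
      linarith only [heb, heX1, hXe, hbX]
    have hWτ0 : 0 ≤ 2 * (38 * (Real.exp (a + h + 1) + 1)) + (Real.exp (a + h + 1) + (a + h + 1)) := by positivity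
    have h1 := pow_le_pow_left₀ hWτ0 hWτ 2
    have h3 : h * Real.exp (a + 2) = Real.exp (2 - a) := by rw [hh, ← Real.exp_add]; ring_nf
    have h4 : Real.exp (2 - a) ^ 2 ≤ Real.exp 4 := by
      rw [← Real.exp_nat_mul]; exact Real.exp_le_exp.2 (by push_cast; linarith only [ha1])
    calc h ^ 2 * (2 * (38 * (Real.exp (a + h + 1) + 1)) + (Real.exp (a + h + 1) + (a + h + 1))) ^ 2
        ≤ h ^ 2 * (154 * Real.exp (a + 2)) ^ 2 := mul_le_mul_of_nonneg_left h1 (sq_nonneg _)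
      _ = 154 ^ 2 * (h * Real.exp (a + 2)) ^ 2 := by ring
      _ = 154 ^ 2 * Real.exp (2 - a) ^ 2 := by rw [h3]
      _ ≤ CW := by rw [hCW]; exact mul_le_mul_of_nonneg_left h4 (by norm_num)
  -- the largeness condition `L + 1 ≤ R₋` and the spectral separation `R₋ − L ≥ e^a/2`
  have hLle : 16 * h ^ 2 * ((a + h + 1) + Real.sinh (a + h + 1)) + 4 * weilArchTail (h * (h / 2))
      ≤ 32 * Real.exp 2 * Real.exp (-a) + 8 * a + 12 := by linarith only [hh2P, hΨ]
  have hpoly : Cq * ((a + 2) ^ 3 + 1) + 8 * a + 13 + 32 * Real.exp 2 * Real.exp (-a) ≤ M₁ * (a + 2) ^ 3 := by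
    rw [hM₁]
    have h1 : 8 * a + 13 ≤ 13 * (a + 2) ^ 3 := by
      have := le_self_pow₀ hX1 (by norm_num : (3 : ℕ) ≠ 0); linarith only [this, ha1]
    have h2 : 32 * Real.exp 2 * Real.exp (-a) ≤ 32 * Real.exp 2 * (a + 2) ^ 3 :=
      mul_le_mul_of_nonneg_left (hea1.trans hX3_1) (by positivity)
    nlinarith only [h1, h2, hCq, hX3_1]
  have hsep : Real.exp a / 2 ≤ (Real.exp a - Cq * ((a + 2) ^ 3 + 1))
      - (16 * h ^ 2 * ((a + h + 1) + Real.sinh (a + h + 1)) + 4 * weilArchTail (h * (h / 2))) := by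
    have h1 : M₁ * (a + 2) ^ 3 ≤ Real.exp a / 2 := by
      have h2 : M₁ * ((a + 2) ^ 3 * Real.exp (-a)) * Real.exp a = M₁ * (a + 2) ^ 3 := by
        calc M₁ * ((a + 2) ^ 3 * Real.exp (-a)) * Real.exp a = M₁ * (a + 2) ^ 3 * (Real.exp (-a) * Real.exp a) := by ring
          _ = M₁ * (a + 2) ^ 3 := by rw [heinv, mul_one]
      have h3 := mul_le_mul_of_nonneg_right hc2.le (Real.exp_pos a).le
      linarith only [h2, h3]
    linarith only [hLle, hpoly, h1, hea]
  have hgapB : 16 * h ^ 2 * ((a + h + 1) + Real.sinh (a + h + 1)) + 4 * weilArchTail (h * (h / 2)) + 1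
      ≤ Real.exp a - Cq * ((a + 2) ^ 3 + 1) := by
    have : (1 : ℝ) ≤ Real.exp a / 2 := by
      have := Real.add_one_le_exp a; linarith only [this, ha1]
    linarith only [hsep, this]
  -- the pieces of the rate
  have hWs : 6 * (38 * (Real.exp (a + h + 1) + 1)) * h ≤ 456 * Real.exp 2 * Real.exp (-a) := by
    rw [hh]; exact weightSum_budget_of_large (a := a) (by linarith only [ha1]) le_rfl
  have hJ : 2 * (2 * (K₁ * (a + h + 1) ^ 5) + 5 * h ^ 2 * (2 * (38 * (Real.exp (a + h + 1) + 1))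
        + (Real.exp (a + h + 1) + (a + h + 1))) ^ 2)
      / ((Real.exp a - Cq * ((a + 2) ^ 3 + 1))
        - (16 * h ^ 2 * ((a + h + 1) + Real.sinh (a + h + 1)) + 4 * weilArchTail (h * (h / 2))))
      ≤ (8 * K₁ + 20 * CW) * (a + 2) ^ 5 * Real.exp (-a) := by
    have hden : 0 < (Real.exp a - Cq * ((a + 2) ^ 3 + 1))
        - (16 * h ^ 2 * ((a + h + 1) + Real.sinh (a + h + 1)) + 4 * weilArchTail (h * (h / 2))) :=
      lt_of_lt_of_le (by positivity) hsep
    rw [div_le_iff₀ hden]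
    have hJc : K₁ * (a + h + 1) ^ 5 ≤ K₁ * (a + 2) ^ 5 := mul_le_mul_of_nonneg_left (pow_le_pow_left₀ hb10 hbX 5) hK₁.le
    have hnum : 2 * (2 * (K₁ * (a + h + 1) ^ 5) + 5 * h ^ 2 * (2 * (38 * (Real.exp (a + h + 1) + 1))
        + (Real.exp (a + h + 1) + (a + h + 1))) ^ 2) ≤ (4 * K₁ + 10 * CW) * (a + 2) ^ 5 := by
      nlinarith only [hJc, hsq, hX5_1, hCW0]
    have hrhs : (4 * K₁ + 10 * CW) * (a + 2) ^ 5 ≤ (8 * K₁ + 20 * CW) * (a + 2) ^ 5 * Real.exp (-a) * (Real.exp a / 2) := by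
      have e : (8 * K₁ + 20 * CW) * (a + 2) ^ 5 * Real.exp (-a) * (Real.exp a / 2)
          = (4 * K₁ + 10 * CW) * (a + 2) ^ 5 * (Real.exp (-a) * Real.exp a) := by ring
      rw [e, heinv, mul_one]
    have hc0 : 0 ≤ (8 * K₁ + 20 * CW) * (a + 2) ^ 5 * Real.exp (-a) := by positivity
    have h4 := mul_le_mul_of_nonneg_left hsep hc0
    linarith only [hnum, hrhs, h4]
  have hη : 11 * h ≤ 11 * (a + 2) ^ 5 * Real.exp (-a) := by nlinarith only [hh_ea, hX5_1, hea]
  -- the two junk terms and the window continuity of `R_c`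
  have hab : a ≤ a + h := by linarith only [hh0]
  obtain ⟨hsinhE, -⟩ := sinh_lower ha1
  have hPa : Real.exp a / 4 ≤ a + Real.sinh a := by linarith only [hsinhE, ha1]
  have hPb : Real.exp a / 4 ≤ (a + h) + Real.sinh (a + h) := by
    have := Real.sinh_le_sinh.2 hab; linarith only [this, hPa, hh0]
  have hPa0 : 0 < a + Real.sinh a := lt_of_lt_of_le (by positivity) hPa
  have hPb0 : 0 < (a + h) + Real.sinh (a + h) := lt_of_lt_of_le (by positivity) hPb
  have hj1 : 25 * (h / 2) * Real.exp (2 * (a + h + 1)) / ((a + h) + Real.sinh (a + h))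
      ≤ 50 * Real.exp 4 * Real.exp (-a) := by
    rw [div_le_iff₀ hPb0]
    have h1 : h * Real.exp (2 * (a + h + 1)) ≤ Real.exp 4 := by
      have e : h * Real.exp (2 * (a + h + 1)) = Real.exp (2 * h + 2) := by
        rw [hh, ← Real.exp_add]; ring_nf
      rw [e]; exact Real.exp_le_exp.2 (by linarith only [hh1])
    have h2 : 50 * Real.exp 4 * Real.exp (-a) * (Real.exp a / 4) = 25 / 2 * Real.exp 4 := by
      calc 50 * Real.exp 4 * Real.exp (-a) * (Real.exp a / 4) = 25 / 2 * Real.exp 4 * (Real.exp (-a) * Real.exp a) := by ring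
        _ = 25 / 2 * Real.exp 4 := by rw [heinv, mul_one]
    have h3 := mul_le_mul_of_nonneg_left hPb (by positivity : (0:ℝ) ≤ 50 * Real.exp 4 * Real.exp (-a))
    have h4 : 25 * (h / 2) * Real.exp (2 * (a + h + 1)) = 25 / 2 * (h * Real.exp (2 * (a + h + 1))) := by ring
    nlinarith only [h1, h2, h3, h4]
  have hcont := abs_coshQuotient_sub_le ha0 hab
  have hj2 : 200 * ((a + h) - a) * Real.exp (2 * (a + h)) / (a + Real.sinh a) ≤ 800 * Real.exp 2 * Real.exp (-a) := by
    rw [div_le_iff₀ hPa0]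
    have h1 : ((a + h) - a) * Real.exp (2 * (a + h)) ≤ Real.exp 2 := by
      have e : ((a + h) - a) * Real.exp (2 * (a + h)) = Real.exp (2 * h) := by
        rw [show (a + h) - a = h by ring, hh, ← Real.exp_add]; ring_nf
      rw [e]; exact Real.exp_le_exp.2 (by linarith only [hh1])
    have h2 : 800 * Real.exp 2 * Real.exp (-a) * (Real.exp a / 4) = 200 * Real.exp 2 := by
      calc 800 * Real.exp 2 * Real.exp (-a) * (Real.exp a / 4) = 200 * Real.exp 2 * (Real.exp (-a) * Real.exp a) := by ring
        _ = 200 * Real.exp 2 := by rw [heinv, mul_one]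
    have h3 := mul_le_mul_of_nonneg_left hPa (by positivity : (0:ℝ) ≤ 800 * Real.exp 2 * Real.exp (-a))
    have h4 : 200 * ((a + h) - a) * Real.exp (2 * (a + h)) = 200 * (((a + h) - a) * Real.exp (2 * (a + h))) := by ring
    nlinarith only [h1, h2, h3, h4]
  have hR := (abs_sub_le_iff.1 hcont).1
  -- collect: every piece is `≤ const·(a+2)⁵e^{−a}`
  have hunit : Real.exp (-a) ≤ (a + 2) ^ 5 * Real.exp (-a) := by nlinarith only [hX5_1, hea]
  have e : (8 * K₁ + 20 * CW + 50 * Real.exp 4 + 1256 * Real.exp 2 + 11) * (a + 2) ^ 5 * Real.exp (-a)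
      = (8 * K₁ + 20 * CW) * (a + 2) ^ 5 * Real.exp (-a) + 11 * (a + 2) ^ 5 * Real.exp (-a)
        + (50 * Real.exp 4 + 1256 * Real.exp 2) * ((a + 2) ^ 5 * Real.exp (-a)) := by ring
  rw [e]
  have h5 := mul_le_mul_of_nonneg_left hunit (by positivity : (0:ℝ) ≤ 50 * Real.exp 4 + 1256 * Real.exp 2)
  refine ⟨ha4, h, K₁ * (a + h + 1) ^ 5, Real.exp a - Cq * ((a + 2) ^ 3 + 1), hh0, hh6, by positivity, hcoupB, hRlowB, hgapB, ?_⟩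
  linarith only [hWs, hJ, hη, hj1, hj2, hR, h5]

end FloorCoshSplit

end Summit.RiemannHypothesis.RiemannHypothesis.Theorems.WeilFormatC
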